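/-
COR-CM (cell pub-hodgecm2, stage 2 of the Hodge ladder) — count-neutral KERNEL COMBINATORICS «μ = φ₂ for EVERY group of order 4p (p an odd prime) and
EVERY central involution» (seat prover-pub-hodgecm2-b23-g50-0, binder prover b23, gen 50; own census lane INDEX-TWO CYCLIC 2-GROUPS, extension «SMALL
DEGREES», claim HOME/INBOX.md l.23042, INTERIM #1 l.23124).  Theorems only; `Census/IndexTwoCyclicNormalForm.lean`, `Census/IndexTwoCyclicOddLevel.lean`,
`Census/IndexTwoCyclicTwoGroups.lean` §1 (cyclic) and `Census/IndexTwoCyclicQuaternion.lean` (this seat) are used BY NAME.  No definition, no `decide`, no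
certificate, no named fact, no `sorry`.  `Interfaces.lean` (C1), every E term, B01, `Transposition/*`, `PortJoin/*`, `D2Bridge/*` untouched.
HONEST FRAMING: `HC_CM` is NOT proved, here or anywhere in the tree; nothing here is a period, a count of record or a headline.
T5: n/a-class (hypothesis binders: `|G| = 4p`, `p` prime `≠ 2`, `c·c = 1`, `c ≠ 1`, `c` central — inhabited by `ℤ/12`; checker: self, 2026-08-25).
-/
import Summits.HodgeConjecture.CorCM.Census.IndexTwoCyclicTwoGroups
import Summits.HodgeConjecture.CorCM.Census.IndexTwoCyclicOddLevel
import Mathlib.GroupTheory.Perm.Cycle.Type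
import HarnessLib

/-!
# The face census of every group of order `4p`, `p` an odd prime: `μ(G, c) = φ₂(G, c)`

A finite group `G` of order `4p` (`p` an odd prime) with a CENTRAL involution `c` contains a cyclic subgroup of index two through `c`: Cauchy gives
`g` of order `p`, and `u = g·c` has order `2p` with `uᵖ = c` (§2).  For `w ∉ ⟨u⟩` with `w u w⁻¹ = uʳ`, `r² ≡ 1 (mod 2p)` forces `r ∈ {1, 2p − 1}`
(§1, `p` prime), and the coset-square formula `(w uⁱ)² = u^{j + (r+1) i}` of `Census/IndexTwoCyclicNormalForm.lean` yields the LEVEL-`p` TRICHOTOMY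
(`exists_involution_or_isCyclic_or_quaternion_of_prime`): an involution outside `⟨u⟩` (split: `ℤ/2p × ℤ/2`, `D_{4p} = D_{2p} × ℤ/2`), or `G` cyclic
(`r = 1`: some `(w uⁱ)²` is prime to `2p`), or the quaternion relations `w² = uᵖ`, `w u w⁻¹ = u⁻¹` (`r = −1`: `Q_{4p} = Dic_p`).  Each branch is a landed
law: the split odd-level law (`Census/IndexTwoCyclicOddLevel.lean`, complement `⟨u², w⟩`), the cyclic law, seat b09ʼs quaternion column transported
(`Census/IndexTwoCyclicQuaternion.lean`, every `n ≥ 2`).  Hence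

* §3 **`isLeast_card_gfaces_generate_fibreTwo_of_card_eq_four_mul_prime (hc2) (hc1) (hcen) (hp : p.Prime) (hp2 : p ≠ 2) (hcard : |G| = 4p)`**:
  `μ(G, c) = φ₂(G, c)` for EVERY group of order `4p` and EVERY central involution — ONE theorem for `ℤ/4p`, `ℤ/2p × ℤ/2` (all three `c`), `D_{4p}`,
  `Q_{4p}`, classification-free.  Census dictionary: every Galois CM field of degree `4p` (`12, 20, 28, 44, 52, …`) has exactly `φ₂(F)` generating faces
  (field level in `CorCM/FaceIndexTwoCyclicSmallDegrees.lean`).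

## References
* [Pohlmann1968] H. Pohlmann, Algebraic cycles on abelian varieties of complex multiplication type, Ann. of Math. 88 (1968), Thm 1.
-/

namespace Summit.HodgeConjecture.CorCM.Census.IndexTwoCyclic

open Finset
open Summit.HodgeConjecture.CorCM.Prior.AllgGroup.RfwfAllgGroup
open Summit.HodgeConjecture.CorCM.Census.BlockParity
open Summit.HodgeConjecture.CorCM.Census.Coinvariant

/-! ## §1 Arithmetic at prime level: `r² ≡ 1 (mod 2p) ⟹ r ≡ ±1` -/

/-- **`r² ≡ 1 (mod 2p)`, `r < 2p`, `p` an odd prime ⟹ `r = 1` or `r = 2p − 1`.** [folklore] -/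
theorem eq_one_or_eq_of_sq_modEq_prime {p r : ℕ} (hp : p.Prime) (hp2 : p ≠ 2) (hr : r < 2 * p) (hrr : r * r ≡ 1 [MOD 2 * p]) :
    r = 1 ∨ r + 1 = 2 * p := by
  have hp1 : 3 ≤ p := by
    have := hp.two_le
    omega
  have hsq : r * r % 2 = 1 := Nat.ModEq.of_mul_right p hrr
  have hodd : Odd r := (Nat.odd_mul.mp (Nat.odd_iff.mpr hsq)).1
  obtain ⟨k, rfl⟩ := hodd
  have h2p : 2 * p ∣ (2 * k + 1) * (2 * k + 1) - 1 := (Nat.modEq_iff_dvd' (by nlinarith)).mp hrr.symm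
  have e : (2 * k + 1) * (2 * k + 1) - 1 = (2 * k) * (2 * k + 2) := by
    have : (2 * k + 1) * (2 * k + 1) = (2 * k) * (2 * k + 2) + 1 := by ring
    omega
  rw [e] at h2p
  have hpdvd : p ∣ (2 * k) * (2 * k + 2) := (Dvd.intro_left 2 rfl).trans h2p
  rcases (hp.dvd_mul).mp hpdvd with h | h
  · -- `p ∣ r - 1 = 2k` and `2 ∣ 2k` ⟹ `2p ∣ 2k < 2p` ⟹ `k = 0`
    have h2 : 2 * p ∣ 2 * k := Nat.Coprime.mul_dvd_of_dvd_of_dvd ((Nat.coprime_primes Nat.prime_two hp).mpr hp2.symm) ⟨k, rfl⟩ h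
    left
    rcases Nat.eq_zero_or_pos k with hk | hk
    · subst hk; rfl
    · exact absurd (Nat.le_of_dvd (by omega) h2) (by omega)
  · -- `p ∣ r + 1 = 2k + 2` and `2 ∣ 2k+2` ⟹ `2p ∣ r + 1 ≤ 2p`
    have h2 : 2 * p ∣ 2 * k + 2 := Nat.Coprime.mul_dvd_of_dvd_of_dvd ((Nat.coprime_primes Nat.prime_two hp).mpr hp2.symm) ⟨k + 1, by ring⟩ h
    right
    obtain ⟨q, hq⟩ := h2
    rcases q with _ | _ | q
    · omega
    · omega
    · nlinarith

/-! ## §2 A cyclic subgroup of index two through a central involution, and the level-`p` trichotomy -/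

/-- **In a group of order `4p` (`p` an odd prime) a central involution `c` lies in a cyclic subgroup of index two**: `u = g·c` (`g` of order `p`,
Cauchy) has order `2p`, `[G : ⟨u⟩] = 2` and `uᵖ = c`. [folklore] -/
theorem exists_index_two_of_card_eq_four_mul_prime {G : Type*} [Group G] [Fintype G] {c : G} (hc2 : c * c = 1) (hc1 : c ≠ 1)
    (hcen : ∀ x : G, x * c = c * x) {p : ℕ} (hp : p.Prime) (hp2 : p ≠ 2) (hcard : Fintype.card G = 4 * p) :
    ∃ u : G, orderOf u = 2 * p ∧ (Subgroup.zpowers u).index = 2 ∧ u ^ p = c := by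
  haveI : Fact p.Prime := ⟨hp⟩
  obtain ⟨g, hg⟩ := exists_prime_orderOf_dvd_card p (by rw [hcard]; exact Dvd.intro_left 4 rfl)
  have hcomm : Commute g c := hcen g
  have hoc : orderOf c = 2 := orderOf_eq_prime (by rw [pow_two, hc2]) hc1
  have hcop : (orderOf g).Coprime (orderOf c) := by
    rw [hg, hoc]
    exact (Nat.coprime_primes hp Nat.prime_two).mpr hp2
  have hord : orderOf (g * c) = 2 * p := by
    rw [hcomm.orderOf_mul_eq_mul_orderOf_of_coprime hcop, hg, hoc, mul_comm]
  refine ⟨g * c, hord, ?_, ?_⟩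
  · have h := (Subgroup.zpowers (g * c)).card_mul_index
    rw [Nat.card_zpowers, hord, Nat.card_eq_fintype_card, hcard] at h
    have : 2 * p * (Subgroup.zpowers (g * c)).index = 2 * p * 2 := by rw [h]; ring
    exact Nat.eq_of_mul_eq_mul_left (Nat.mul_pos two_pos hp.pos) this
  · obtain ⟨k, hk⟩ := hp.odd_of_ne_two hp2
    have hgp : g ^ p = 1 := by rw [← hg]; exact pow_orderOf_eq_one g
    rw [hcomm.mul_pow, hgp, one_mul, hk, pow_succ, pow_mul, pow_two, hc2, one_pow, one_mul]

/-- **THE LEVEL-`p` TRICHOTOMY** (`p` an odd prime): `u` of order `2p` with `[G : ⟨u⟩] = 2` ⟹ EITHER some element outside `⟨u⟩` is an involution, OR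
`G` is cyclic, OR some `w ∉ ⟨u⟩` satisfies `w² = uᵖ`, `w u w⁻¹ = u⁻¹`. [folklore] -/
theorem exists_involution_or_isCyclic_or_quaternion_of_prime {G : Type*} [Group G] [Finite G] (u : G) {p : ℕ} (hp : p.Prime) (hp2 : p ≠ 2)
    (hord : orderOf u = 2 * p) (hindex : (Subgroup.zpowers u).index = 2) :
    (∃ w : G, w ∉ Subgroup.zpowers u ∧ w * w = 1) ∨ IsCyclic G ∨
      (∃ w : G, w ∉ Subgroup.zpowers u ∧ w * w = u ^ p ∧ w * u * w⁻¹ = u⁻¹) := by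
  by_cases hinv : ∃ w : G, w ∉ Subgroup.zpowers u ∧ w * w = 1
  · exact Or.inl hinv
  push Not at hinv
  obtain ⟨w, hw⟩ := exists_notMem_of_index_two hindex
  obtain ⟨r, hr, hwu⟩ := exists_pow_eq_of_mem_zpowers (conj_mem_zpowers_of_index_two hindex w)
  obtain ⟨j, hj, hww⟩ := exists_pow_eq_of_mem_zpowers (mul_self_mem_of_index_two hindex w)
  rw [hord] at hr hj
  have hp1 : 3 ≤ p := by
    have := hp.two_le
    omega
  have hrr : r * r ≡ 1 [MOD 2 * p] := by
    rw [← hord, ← pow_eq_pow_iff_modEq, pow_one]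
    exact pow_r_mul_r_eq hwu.symm hww.symm
  have hrj : r * j ≡ j [MOD 2 * p] := by
    rw [← hord, ← pow_eq_pow_iff_modEq]
    exact pow_r_mul_j_eq hwu.symm hww.symm
  have hsq : ∀ i : ℕ, (w * u ^ i) * (w * u ^ i) = u ^ (j + (r + 1) * i) := coset_mul_self hwu.symm hww.symm
  have hout : ∀ i : ℕ, w * u ^ i ∉ Subgroup.zpowers u := fun i h =>
    hw ((Subgroup.mul_mem_cancel_right _ (Subgroup.pow_mem _ (Subgroup.mem_zpowers u) i)).mp h)
  have hno : ∀ i : ℕ, ¬ 2 * p ∣ j + (r + 1) * i := by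
    intro i hi
    apply hinv (w * u ^ i) (hout i)
    rw [hsq, ← orderOf_dvd_iff_pow_eq_one, hord]
    exact hi
  rcases eq_one_or_eq_of_sq_modEq_prime hp hp2 hr hrr with rfl | hr1
  · -- `r = 1`: `G` is abelian-by-construction; no involution ⟹ `j` odd ⟹ some `(w uⁱ)² = u^{j+2i}` is prime to `2p` ⟹ cyclic
    right; left
    have hjodd : Odd j := by
      by_contra hev
      rw [Nat.not_odd_iff_even] at hev
      obtain ⟨j', rfl⟩ := hev
      refine hno ((p - 1) * j') ⟨j', ?_⟩
      obtain ⟨k, hk⟩ : ∃ k, p = k + 1 := ⟨p - 1, by omega⟩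
      rw [hk, Nat.add_sub_cancel]
      ring
    -- choose `i ∈ {0, 1}` with `p ∤ j + 2 i`
    obtain ⟨i, hi⟩ : ∃ i : ℕ, ¬ p ∣ j + (1 + 1) * i := by
      by_cases h0 : p ∣ j
      · refine ⟨1, fun h1 => ?_⟩
        have h2 : p ∣ 2 := (Nat.dvd_add_right h0).mp (by simpa using h1)
        exact hp2 ((Nat.prime_dvd_prime_iff_eq hp Nat.prime_two).mp h2)
      · exact ⟨0, by simpa using h0⟩
    have hcop : (j + (1 + 1) * i).Coprime (orderOf u) := by
      rw [hord]
      refine Nat.Coprime.mul_right ?_ ?_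
      · exact (Nat.prime_two.coprime_iff_not_dvd.mpr (by obtain ⟨m, hm⟩ := hjodd; omega)).symm
      · exact (hp.coprime_iff_not_dvd.mpr hi).symm
    exact isCyclic_of_mul_self_eq_pow hindex (hout i) (hsq i) hcop
  · -- `r = 2p − 1`: `r j ≡ j` ⟹ `p ∣ j` ⟹ `j = p` (`j = 0` would be an involution): the quaternion relations
    right; right
    have hjj : 2 * p ∣ j + j := by
      have h : r * j + j ≡ j + j [MOD 2 * p] := Nat.ModEq.add_right j hrj
      have e : r * j + j = 2 * p * j := by
        have : r * j + j = (r + 1) * j := by ring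
        rw [this, hr1]
      rw [e] at h
      exact Nat.modEq_zero_iff_dvd.mp (h.symm.trans (Nat.modEq_zero_iff_dvd.mpr (dvd_mul_right _ _)))
    have hjp : j = p := by
      rcases eq_or_eq_of_dvd_of_le (Nat.dvd_of_mul_dvd_mul_left (by norm_num : 0 < 2) (by simpa [two_mul] using hjj))
        (fun h => hno 0 ⟨0, by simp [h]⟩) (by omega) with h | h
      · exact h
      · omega
    refine ⟨w, hw, by rw [← hww, hjp], ?_⟩
    rw [← hwu]
    apply eq_inv_of_mul_eq_one_left
    rw [← pow_succ, hr1, ← hord, pow_orderOf_eq_one]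

/-! ## §3 The census of every group of order `4p` -/

/-- **THE FACE CENSUS OF EVERY GROUP OF ORDER `4p` (`p` AN ODD PRIME): `μ(G, c) = φ₂(G, c)`** for EVERY central involution `c` — one theorem for
`ℤ/4p`, `ℤ/2p × ℤ/2` (all three central involutions), `D_{4p}`, `Q_{4p}`, classification-free. [folklore] -/
theorem isLeast_card_gfaces_generate_fibreTwo_of_card_eq_four_mul_prime {G : Type*} [Group G] [Fintype G] [DecidableEq G] {c : G}
    (hc2 : c * c = 1) (hc1 : c ≠ 1) (hcen : ∀ x : G, x * c = c * x) {p : ℕ} (hp : p.Prime) (hp2 : p ≠ 2)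
    (hcard : Fintype.card G = 4 * p) :
    IsLeast {m : ℕ | ∃ S : Finset (CMF G c →₀ ℤ), ↑S ⊆ gfaceSet G c hc2 ∧ S.card = m ∧
      hodgeSpan c hc2 ≤ Submodule.span ℤ (pairSet c) ⊔ Submodule.span ℤ (translates c S)} (fibreTwo c hc2) := by
  obtain ⟨u, hord, hindex, hun⟩ := exists_index_two_of_card_eq_four_mul_prime hc2 hc1 hcen hp hp2 hcard
  have hp1 : 3 ≤ p := by
    have := hp.two_le
    omega
  rcases exists_involution_or_isCyclic_or_quaternion_of_prime u hp hp2 hord hindex with ⟨w, hw, hww⟩ | hcyc | ⟨w, hw, hww, hwu⟩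
  · exact isLeast_card_gfaces_generate_fibreTwo_of_involution_odd hc2 hc1 u w (hp.odd_of_ne_two hp2) hun hord hindex hw hww
  · haveI : IsCyclic G := hcyc
    exact isLeast_card_gfaces_generate_fibreTwo_of_isCyclic hc2 hc1
  · exact isLeast_card_gfaces_generate_fibreTwo_of_quaternion hc2 u w hun hord hindex hw (hww.trans hun) hwu (by omega)

end Summit.HodgeConjecture.CorCM.Census.IndexTwoCyclic
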